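import Summits.MatrixMultiplication.MatrixMultiplication.Theorems.TetraDiagonalTriangles
import Summits.MatrixMultiplication.MatrixMultiplication.Theorems.TetraDiagonalCover
import Summits.MatrixMultiplication.MatrixMultiplication.Theorems.TetraDiagonalLimit
import Literature.Computability.AlgebraicComplexity.RectangularExponentSymmetry
import HarnessLib

/-!
# TetraDiagonalRungs — the half-triangle cover `ω_diag(ε) ≤ 2·ω(1,ε,1)` and the proved rungs
`ω_diag(ε) = 4` for `ε ≤ α`

(decomp-mm lens 6, generation 19; kernel D2 of NODE-g19 §2(d)(iv), continuing `TetraDiagonalTriangles`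
(finite cover), `TetraDiagonalCover` (level monotonicity) and `TetraDiagonalLimit`. Cut of record
UNCHANGED: leaf `TetraFlat` = item 33477, residual `TetraNoSaving` = item 33478; theorems about the
instrument `ω_diag`, no item.)

WHAT IS PROVED (sorry-free, no new definition / axiom / instance / notation):
* §17 `two_mul_mem_diagAdmissibleExponents_of_mid`: `β` admissible for `⟨n, ⌈n^ε⌉, n⟩` ⟹ `2β` admissible
  for the thin-diagonal family (`0 ≤ ε ≤ 1`; level `m ↦` square level `N² ≥ m`, `N = ⌊√m⌋+1`, diagonal
  `⌈m^ε⌉ ≤ ⌈N^ε⌉²`, then `R₄(Z_{N²}^{(⌈N^ε⌉²)}) ≤ R(⟨⌈N^ε⌉,N,N⟩)⁴`), and THE HALF-TRIANGLE COVER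
  `omegaDiag_le_two_mul_omegaRect : ω_diag(ε) ≤ 2·ω(1,ε,1)` over every field.
* §18 THE PROVED RUNGS: `ω_diag(ε) = 4` for every `0 ≤ ε ≤ α` (`omegaDiag_eq_four_of_le_dualExponentAlpha`,
  with `ω(1,α,1) = 2`; hence unconditionally for `ε ≤ 0.1722` over every field by the tree theorem
  `coppersmith1982_dualExponentAlpha_gt : 0.1722 < α` of `Coppersmith1982RapidRectangular`, not imported
  here); the RUNG WINDOW `ε ≤ α ⟹ rung(ε) ⟹ ε/2 ≤ α`
  (`omegaDiag_rung_window`, with `TetraDiagonalLadder`); and for the leaf: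
  `tetraFlat_iff_rungs_above_alpha : TetraFlat ↔ ∀ ε ∈ (α, 1), ω_diag(ε) ≤ 4` — the diagonal ladder
  towards item 33477 is PROVED on `[0, α]` and open exactly on `(α, 1)` (BC5-type witnesses of the leaf in
  a regime where the summit is not known: `ω_diag(ε) = 4` is a theorem for `ε ≤ α`, while
  `2ω ≤ ω_diag(ε)` there is summit-equivalent, `TetraDiagonalCostume`).
Sources: [corpus:paper-arxiv-1609.07476 Prop. 1.1.26, §2.1] · [LeGall2012, §1 (α)] ·
tree `RectangularExponentAlpha`, `RectangularExponentSymmetry`.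
-/

noncomputable section

set_option linter.dupNamespace false

open scoped BigOperators
open Filter Asymptotics
open Literature.Computability.AlgebraicComplexity
open Summit.MatrixMultiplication.MatrixMultiplication.Theorems.TetrahedronTensor
open Summit.MatrixMultiplication.MatrixMultiplication.Theses.TetrahedronCarving

namespace Summit.MatrixMultiplication.MatrixMultiplication.Theorems.TetraDiagonal

/-! ## §17 The half-triangle cover in exponents: `ω_diag(ε) ≤ 2·ω(1,ε,1)` -/

section Cover

variable (F : Type) [Field F]

/-- **`β` admissible for `(1, ε, 1)` ⟹ `2β` admissible for the thin-diagonal family** (`0 ≤ ε ≤ 1`).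
[cite: ChristandlVranaZuiddam2016, Prop. 1.1.26 (proof)] -/
theorem two_mul_mem_diagAdmissibleExponents_of_mid {ε β : ℝ} (hε0 : 0 ≤ ε) (hε1 : ε ≤ 1)
    (hβ : β ∈ rectAdmissibleExponents F 1 ε 1) : 2 * β ∈ diagAdmissibleExponents F ε := by
  have hβ2 : 2 ≤ β :=
    (two_le_omegaRect_one_mid_one F ε).trans
      (csInf_le (rectAdmissibleExponents_one_mid_one_bddBelow F ε) hβ)
  have hβ0 : 0 ≤ β := by linarith
  -- transport to the format `(ε, 1, 1)` of the finite cover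
  have hβ' : β ∈ rectAdmissibleExponents F ε 1 1 := by
    rw [rectAdmissibleExponents_rotate, ← rectAdmissibleExponents_one_mid_one]
    exact hβ
  obtain ⟨C, hC0, hC⟩ := bound_of_isBigO_nat_atTop hβ'
  refine IsBigO.of_bound (C ^ 4 * (4 : ℝ) ^ (2 * β)) ?_
  filter_upwards [eventually_ge_atTop 1] with m hm
  have hm0 : (0 : ℝ) < m := by exact_mod_cast hm
  set N := Nat.sqrt m + 1 with hNdef
  have hN1 : 1 ≤ N := by omega
  have hN0 : (0 : ℝ) < N := by exact_mod_cast hN1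
  have hmN : m ≤ N * N := (Nat.le_succ m).trans (Nat.succ_le_succ_sqrt m)
  -- the diagonal `e = ⌈N^ε⌉ ≤ N`, with `⌈m^ε⌉ ≤ e·e`
  have heN : rectDim N ε ≤ N := by
    have h := rectDim_mono hN1 hε1
    rwa [rectDim_one] at h
  have hde : rectDim m ε ≤ rectDim N ε * rectDim N ε := by
    unfold rectDim
    refine Nat.ceil_le.2 ?_
    have h1 : (m : ℝ) ^ ε ≤ ((N : ℝ) * N) ^ ε :=
      Real.rpow_le_rpow hm0.le (by exact_mod_cast hmN) hε0
    have h2 : ((N : ℝ) * N) ^ ε = (N : ℝ) ^ ε * (N : ℝ) ^ ε := Real.mul_rpow hN0.le hN0.le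
    have h3 : (N : ℝ) ^ ε ≤ (⌈(N : ℝ) ^ ε⌉₊ : ℝ) := Nat.le_ceil _
    have h4 : (0 : ℝ) ≤ (N : ℝ) ^ ε := Real.rpow_nonneg hN0.le _
    push_cast
    calc (m : ℝ) ^ ε ≤ (N : ℝ) ^ ε * (N : ℝ) ^ ε := h1.trans_eq h2
      _ ≤ (⌈(N : ℝ) ^ ε⌉₊ : ℝ) * (⌈(N : ℝ) ^ ε⌉₊ : ℝ) := mul_le_mul h3 h3 h4 (h4.trans h3)
  -- the finite chain: level up to `N·N`, diagonal up to `e·e`, then the four half-triangles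
  have hfin : tensorRankD (diagTetra F m (rectDim m ε)) ≤
      tensorRank (matMulTensor F (rectDim N ε) N N) ^ 4 :=
    (tensorRankD_diagTetra_level_mono hmN).trans
      ((tensorRankD_diagTetra_mono hde).trans (tensorRankD_diagTetra_sq_le heN))
  -- the rectangular bound at `N`
  have hRN : (tensorRank (matMulTensor F (rectDim N ε) N N) : ℝ) ≤ C * (N : ℝ) ^ β := by
    have h := hC (Real.rpow_pos_of_pos hN0 β).ne'
    rwa [Real.norm_of_nonneg (Nat.cast_nonneg _), Real.norm_of_nonneg (Real.rpow_nonneg hN0.le _),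
      tensorRank_matMulTensor_congr F rfl (rectDim_one N) (rectDim_one N)] at h
  rw [Real.norm_of_nonneg (Nat.cast_nonneg _), Real.norm_of_nonneg (Real.rpow_nonneg hm0.le _)]
  have hNN : N * N ≤ 4 * m := by
    have hs : 1 ≤ Nat.sqrt m := Nat.le_sqrt.2 (by simpa using hm)
    have hs2 : Nat.sqrt m * Nat.sqrt m ≤ m := Nat.sqrt_le m
    nlinarith [hs, hs2]
  have step1 : (tensorRankD (diagTetra F m (rectDim m ε)) : ℝ) ≤ (C * (N : ℝ) ^ β) ^ 4 := by
    calc (tensorRankD (diagTetra F m (rectDim m ε)) : ℝ)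
        ≤ ((tensorRank (matMulTensor F (rectDim N ε) N N) : ℝ)) ^ 4 := by exact_mod_cast hfin
      _ ≤ (C * (N : ℝ) ^ β) ^ 4 := pow_le_pow_left₀ (Nat.cast_nonneg _) hRN 4
  have step2 : ((N : ℝ) ^ β) ^ 4 ≤ (4 : ℝ) ^ (2 * β) * (m : ℝ) ^ (2 * β) := by
    have hββ : 0 ≤ 2 * β := by linarith
    calc ((N : ℝ) ^ β) ^ 4 = ((N : ℝ) ^ (2 : ℝ)) ^ (2 * β) := by
            rw [← Real.rpow_natCast ((N : ℝ) ^ β) 4, ← Real.rpow_mul hN0.le, ← Real.rpow_mul hN0.le]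
            norm_num
            ring_nf
      _ ≤ ((4 * m : ℕ) : ℝ) ^ (2 * β) := by
            refine Real.rpow_le_rpow (by positivity) ?_ hββ
            rw [Real.rpow_two]
            exact_mod_cast (by simpa [sq] using hNN : N ^ 2 ≤ 4 * m)
      _ = (4 : ℝ) ^ (2 * β) * (m : ℝ) ^ (2 * β) := by
            push_cast
            exact Real.mul_rpow (by norm_num) (Nat.cast_nonneg _)
  calc (tensorRankD (diagTetra F m (rectDim m ε)) : ℝ) ≤ (C * (N : ℝ) ^ β) ^ 4 := step1
    _ = C ^ 4 * ((N : ℝ) ^ β) ^ 4 := mul_pow _ _ _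
    _ ≤ C ^ 4 * ((4 : ℝ) ^ (2 * β) * (m : ℝ) ^ (2 * β)) :=
          mul_le_mul_of_nonneg_left step2 (pow_nonneg hC0.le 4)
    _ = C ^ 4 * (4 : ℝ) ^ (2 * β) * (m : ℝ) ^ (2 * β) := by ring

/-- **The half-triangle cover `ω_diag(ε) ≤ 2·ω(1,ε,1)`** (`0 ≤ ε ≤ 1`, every field): the four triangles of
`Z^ε` are rectangular `⟨n^ε, n, n⟩`, two through each matching edge. With the restriction bound
`ω_diag(ε) ≤ ω(K₄)` and the chord `ω_diag(ε) ≤ 4(1-ε) + ε·ω(K₄)` (`TetraDiagonalCover`) this is the third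
upper profile of the thin-diagonal exponent. [cite: ChristandlVranaZuiddam2016, Prop. 1.1.26] -/
theorem omegaDiag_le_two_mul_omegaRect {ε : ℝ} (hε0 : 0 ≤ ε) (hε1 : ε ≤ 1) :
    omegaDiag F ε ≤ 2 * omegaRect F 1 ε 1 := by
  have h : ∀ β ∈ rectAdmissibleExponents F 1 ε 1, omegaDiag F ε / 2 ≤ β := fun β hβ => by
    have h2 := csInf_le (diagAdmissibleExponents_bddBelow F hε1)
      (two_mul_mem_diagAdmissibleExponents_of_mid F hε0 hε1 hβ)
    change omegaDiag F ε ≤ 2 * β at h2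
    linarith
  have h3 := le_csInf (rectAdmissibleExponents_nonempty F 1 ε 1) h
  change omegaDiag F ε / 2 ≤ omegaRect F 1 ε 1 at h3
  linarith

/-- The three upper profiles together: `ω_diag(ε) ≤ min (ω(K₄), 4(1-ε) + ε·ω(K₄), 2·ω(1,ε,1))`.
[cite: ChristandlVranaZuiddam2016, Prop. 1.1.16, Prop. 1.1.26] -/
theorem omegaDiag_le_min₃ {ε : ℝ} (hε0 : 0 ≤ ε) (hε1 : ε ≤ 1) :
    omegaDiag F ε ≤ min (omegaTetra F) (min (4 * (1 - ε) + ε * omegaTetra F) (2 * omegaRect F 1 ε 1)) :=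
  le_min (omegaDiag_le_omegaTetra F hε1)
    (le_min (omegaDiag_le_cover F hε0 hε1) (omegaDiag_le_two_mul_omegaRect F hε0 hε1))

end Cover

/-! ## §18 The proved rungs `ω_diag(ε) = 4` for `ε ≤ α`, the rung window, and the leaf -/

section Rungs

variable (F : Type) [Field F]

/-- **Proved rungs**: `ω_diag(ε) = 4` for every `0 ≤ ε ≤ α` (`ω(1,ε,1) = 2` there). In particular the
thin-diagonal tetrahedra `Z^ε`, `ε ≤ α`, are FLAT — a decided instance of the leaf's ladder in a regime
where the summit `ω = 2` is not known. [cite: LeGall2012, §1] -/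
theorem omegaDiag_eq_four_of_le_dualExponentAlpha {ε : ℝ} (hε0 : 0 ≤ ε)
    (hε : ε ≤ dualExponentAlpha F) : omegaDiag F ε = 4 := by
  have hε1 : ε ≤ 1 := hε.trans (dualExponentAlpha_le_one F)
  refine le_antisymm ?_ (four_le_omegaDiag F hε1)
  have h := omegaDiag_le_two_mul_omegaRect F hε0 hε1
  rw [omegaRect_eq_two_of_le_dualExponentAlpha F hε] at h
  linarith

/-- **The rung window**: `ε ≤ α ⟹ [ω_diag(ε) ≤ 4] ⟹ ε/2 ≤ α` (`0 ≤ ε ≤ 1`; the second implication is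
`TetraDiagonalLadder.half_eps_le_dualExponentAlpha_of_omegaDiag_le_four`, the `{2,3}`-merged shadow
`ω(2,ε,2) ≤ 4`). So the rung frontier `sup {ε | ω_diag(ε) = 4}` lies in `[α, 2α]`. [cite: LeGall2012, §1] -/
theorem omegaDiag_rung_window {ε : ℝ} (hε0 : 0 ≤ ε) (hε1 : ε ≤ 1) :
    (ε ≤ dualExponentAlpha F → omegaDiag F ε ≤ 4) ∧
      (omegaDiag F ε ≤ 4 → ε / 2 ≤ dualExponentAlpha F) :=
  ⟨fun h => (omegaDiag_eq_four_of_le_dualExponentAlpha F hε0 h).le,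
    half_eps_le_dualExponentAlpha_of_omegaDiag_le_four F hε0 hε1⟩

/-- Above the window the cover still controls the defect: `ω_diag(ε) - 4 ≤ 2·(ω(1,ε,1) - 2)`.
[cite: ChristandlVranaZuiddam2016, Prop. 1.1.26] -/
theorem omegaDiag_defect_le_two_mul {ε : ℝ} (hε0 : 0 ≤ ε) (hε1 : ε ≤ 1) :
    omegaDiag F ε - 4 ≤ 2 * (omegaRect F 1 ε 1 - 2) := by
  have h := omegaDiag_le_two_mul_omegaRect F hε0 hε1
  linarith

/-- **The leaf and the ladder.** `TetraFlat` (item 33477, `ω(K₄) ≤ 4` over `ℂ`) holds iff the rungs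
`ω_diag(ε) ≤ 4` hold for every `ε ∈ (α, 1)`: the rungs on `[0, α]` are theorems
(`omegaDiag_eq_four_of_le_dualExponentAlpha`) and the ladder converges to the leaf
(`TetraDiagonalLimit.tetraFlat_iff_forall_omegaDiag_le_four`). (decomp-mm lens 6, NODE-g19 §2(d)). -/
theorem tetraFlat_iff_rungs_above_alpha :
    TetraFlat ↔ ∀ ε : ℝ, dualExponentAlpha ℂ < ε → ε < 1 → omegaDiag ℂ ε ≤ 4 := by
  rw [tetraFlat_iff_forall_omegaDiag_le_four]
  constructor
  · intro h ε hα hε1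
    exact h ε ((dualExponentAlpha_nonneg ℂ).trans hα.le) hε1
  · intro h ε hε0 hε1
    rcases le_or_gt ε (dualExponentAlpha ℂ) with hle | hlt
    · exact (omegaDiag_eq_four_of_le_dualExponentAlpha ℂ hε0 hle).le
    · exact h ε hlt hε1

/-- Under the summit statement every rung holds (`α = 1`); conversely the rungs on `(α,1)` plus the
residual `TetraNoSaving` (item 33478) give the summit (tensor-level
`TetrahedronTensor.matrixMultiplication_of_tetra`; the route's `closes` was re-keyed to the weaker leaf
`TetraExcessZero` at rev 5, 2026-08-30, so it is no longer used here). [cite: LeGall2012, §1] -/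
theorem matrixMultiplication_iff_rungs_above_alpha_and_noSaving :
    _root_.MatrixMultiplication ↔
      (∀ ε : ℝ, dualExponentAlpha ℂ < ε → ε < 1 → omegaDiag ℂ ε ≤ 4) ∧ TetraNoSaving := by
  rw [← tetraFlat_iff_rungs_above_alpha]
  exact ⟨fun h => ⟨omegaTetra_le_four_of_matrixMultiplication h,
    two_mul_omega_le_omegaTetra_of_matrixMultiplication h⟩,
    fun h => Summit.MatrixMultiplication.MatrixMultiplication.Theorems.TetrahedronTensor.matrixMultiplication_of_tetra
      h.1 h.2⟩

end Rungs

end Summit.MatrixMultiplication.MatrixMultiplication.Theorems.TetraDiagonal
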